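import Mathlib.LinearAlgebra.Matrix.Determinant.Basic
import Literature.Analysis.FluidPDE.VectorCalculus
import Literature.Analysis.FluidPDE.AxisymmetricVorticityTransport
import HarnessLib

/-!
# The vorticity of an equivariant field is equivariant under proper rotations — crux
  stmt-NavierStokesRegularity-1404 (`QuantisedSymmetry.PolyhedralDssProfileExists`), line
  polyhedral_cell, stub stub_curlEquivariant (N26)

Registered stub `stub_curlEquivariant` (`--supports stmt-NavierStokesRegularity-1404`). Let `g` be
a linear isometry of `ℝ³ = EuclideanSpace ℝ (Fin 3)` of determinant `1` (a proper rotation) and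
let `w : ℝ³ → ℝ³` be differentiable and `g`-equivariant, `w (g x) = g (w x)`. Then the vorticity
is `g`-equivariant as well: `curl w (g x) = g (curl w x)` (Majda–Bertozzi, *Vorticity and
incompressible flow*, §1.2, Prop. 1.1 (rotation symmetry); the kinematic fact that `ω = curl v`
transforms as a vector under `SO(3)`). Together with the landed N20 (`stub_axisAlignment`) this
puts the vorticity of a `T/O/I`-equivariant witness along each rotation axis on that axis.

Proof sketch.
* Chain rule (`fderiv_conj_linearIsometryEquiv`, `IsometryInvariance`): `w = g ∘ w ∘ g⁻¹`, so
  `Dw(g x) = g ∘ Dw(x) ∘ g⁻¹`.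
* Algebra (`curlEquivariant_curlCLM_conj`): for every linear `A` and every linear isometry `g`
  with `det g = 1`, `curlvec (g A g⁻¹) = g (curlvec A)` (`curlvec = curlCLM`, the axial vector
  of `A − Aᵀ`). In the standard basis let `M` be the matrix of `g`; it is orthogonal
  (`M Mᵀ = 1`, from `⟪g⁻¹ eᵢ, g⁻¹ eₖ⟫ = δᵢₖ` and `g⁻¹ = gᵀ`) with `det M = 1`. The polynomial
  identity `Mᵀ curlvec (M A Mᵀ) = det M · curlvec A` (valid for ALL `3 × 3` matrices — the
  cofactor identity `M u × M v = cof(M) (u × v)` in disguise; checked by `ring`,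
  `curlEquivariant_poly`) then gives `curlvec (M A Mᵀ) = M Mᵀ curlvec (M A Mᵀ) = M curlvec A`
  (`curlEquivariant_conj_eq`).
* Assemble with `curl v x = curlCLM (Dv(x))` (`curl_eq_curlCLM`, definitional).

The matrix lemmas are stated on plain arrays `Fin 3 → Fin 3 → ℝ`, with the curl vectors and the
conjugated array characterised by hypotheses (no auxiliary definitions).
-/

noncomputable section

-- the summit namespace `…NavierStokesRegularity.NavierStokesRegularity…` is the tree convention (D-0017)
set_option linter.dupNamespace false

namespace Summit.NavierStokesRegularity.NavierStokesRegularity.Theorems.PolyhedralDssProfileExists.PolyhedralCell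

open Literature.Analysis Literature.Analysis.FluidPDE
open scoped InnerProductSpace RealInnerProductSpace

/-! ### Matrix algebra over `Fin 3` (plain real arrays) -/

/-- **The polynomial identity behind rotation covariance of the curl.** Index a `3 × 3` array as
`B j i = (B eⱼ)ᵢ`, so that its curl vector (`curlCLM_apply`) is
`C = (B₁₂ − B₂₁, B₂₀ − B₀₂, B₀₁ − B₁₀)`. If `m i j = (g eⱼ)ᵢ` is the matrix of `g`,
`a l k = (A eₗ)ₖ` the array of `A`, `B` the array of `g A gᵀ` (`B j i = ∑ₖ ∑ₗ mᵢₖ mⱼₗ aₗₖ`), `C`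
its curl vector and `c` that of `a`, then `Mᵀ C = det M · c` for ALL `m` (no orthogonality):
the cofactor identity `M u × M v = cof(M) (u × v)` in disguise. Checked by `ring`. [folklore] -/
theorem curlEquivariant_poly (m a B : Fin 3 → Fin 3 → ℝ) (C c : Fin 3 → ℝ)
    (hB : ∀ j i, B j i = ∑ k, ∑ l, m i k * (m j l * a l k))
    (hC : ∀ k, C k = ![B 1 2 - B 2 1, B 2 0 - B 0 2, B 0 1 - B 1 0] k)
    (hc : ∀ k, c k = ![a 1 2 - a 2 1, a 2 0 - a 0 2, a 0 1 - a 1 0] k) (i : Fin 3) :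
    ∑ k, m k i * C k =
      (m 0 0 * m 1 1 * m 2 2 - m 0 0 * m 1 2 * m 2 1 - m 0 1 * m 1 0 * m 2 2 +
        m 0 1 * m 1 2 * m 2 0 + m 0 2 * m 1 0 * m 2 1 - m 0 2 * m 1 1 * m 2 0) * c i := by
  fin_cases i <;>
    simp only [hB, hC, hc, Fin.sum_univ_three, Fin.isValue, Fin.zero_eta, Fin.mk_one,
      Fin.reduceFinMk, Matrix.cons_val_zero, Matrix.cons_val_one, Matrix.cons_val_two,
      Matrix.head_cons, Matrix.tail_cons] <;>
    ring

/-- **Orthogonal, determinant-one case**: in the setting of `curlEquivariant_poly`, if the rows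
of `m` are orthonormal (`M Mᵀ = 1`) and `det M = 1`, then `C = M c`, i.e.
`curlvec (M A Mᵀ) = M curlvec A` (`C = M Mᵀ C = M (det M · c)`). [folklore] -/
theorem curlEquivariant_conj_eq (m a B : Fin 3 → Fin 3 → ℝ) (C c : Fin 3 → ℝ)
    (hB : ∀ j i, B j i = ∑ k, ∑ l, m i k * (m j l * a l k))
    (hC : ∀ k, C k = ![B 1 2 - B 2 1, B 2 0 - B 0 2, B 0 1 - B 1 0] k)
    (hc : ∀ k, c k = ![a 1 2 - a 2 1, a 2 0 - a 0 2, a 0 1 - a 1 0] k)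
    (hrow : ∀ i k : Fin 3, ∑ j, m i j * m k j = if i = k then 1 else 0)
    (hdet : m 0 0 * m 1 1 * m 2 2 - m 0 0 * m 1 2 * m 2 1 - m 0 1 * m 1 0 * m 2 2 +
        m 0 1 * m 1 2 * m 2 0 + m 0 2 * m 1 0 * m 2 1 - m 0 2 * m 1 1 * m 2 0 = 1)
    (i : Fin 3) : C i = ∑ j, m i j * c j := by
  calc C i = ∑ k, (if i = k then 1 else 0) * C k := by
        simp only [ite_mul, one_mul, zero_mul, Finset.sum_ite_eq, Finset.mem_univ, if_true]
    _ = ∑ k, (∑ j, m i j * m k j) * C k := by simp only [hrow]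
    _ = ∑ j, m i j * ∑ k, m k j * C k := by
        simp only [Finset.sum_mul, Finset.mul_sum]
        rw [Finset.sum_comm]
        refine Finset.sum_congr rfl fun j _ => Finset.sum_congr rfl fun k _ => ?_
        ring
    _ = ∑ j, m i j * c j := by
        refine Finset.sum_congr rfl fun j _ => ?_
        rw [curlEquivariant_poly m a B C c hB hC hc, hdet, one_mul]

/-! ### The curl of a conjugated Jacobian -/

/-- **Rotation covariance of the curl (algebraic form)**: for a linear isometry `g` of `ℝ³` with
`det g = 1` and every linear `A`, `curlCLM (g ∘ A ∘ g⁻¹) = g (curlCLM A)` — the axial vector of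
`A − Aᵀ` transforms as a vector under proper rotations (for `det g = -1` it picks up a sign).
Coordinates: `g⁻¹ = gᵀ` in the standard basis (`⟪eₗ, g⁻¹ eⱼ⟫ = ⟪g eₗ, eⱼ⟫`), the rows of the
matrix of `g` are orthonormal, `det` via `LinearMap.det_toMatrix` and `Matrix.det_fin_three`,
then `curlEquivariant_conj_eq`. [folklore] -/
theorem curlEquivariant_curlCLM_conj
    (g : EuclideanSpace ℝ (Fin 3) ≃ₗᵢ[ℝ] EuclideanSpace ℝ (Fin 3))
    (hdet : LinearMap.det
      (g.toLinearEquiv : EuclideanSpace ℝ (Fin 3) →ₗ[ℝ] EuclideanSpace ℝ (Fin 3)) = 1)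
    (A : EuclideanSpace ℝ (Fin 3) →L[ℝ] EuclideanSpace ℝ (Fin 3)) :
    curlCLM ((g : EuclideanSpace ℝ (Fin 3) →L[ℝ] EuclideanSpace ℝ (Fin 3)).comp
      (A.comp (g.symm : EuclideanSpace ℝ (Fin 3) →L[ℝ] EuclideanSpace ℝ (Fin 3)))) =
      g (curlCLM A) := by
  -- the matrix of `g` and the array of `A` in the standard basis (opaque names, no simp loops)
  obtain ⟨m, hm⟩ : ∃ m : Fin 3 → Fin 3 → ℝ,
      ∀ i j, g (EuclideanSpace.single j (1 : ℝ)) i = m i j :=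
    ⟨fun i j => g (EuclideanSpace.single j (1 : ℝ)) i, fun _ _ => rfl⟩
  obtain ⟨a, ha⟩ : ∃ a : Fin 3 → Fin 3 → ℝ,
      ∀ l k, A (EuclideanSpace.single l (1 : ℝ)) k = a l k :=
    ⟨fun l k => A (EuclideanSpace.single l (1 : ℝ)) k, fun _ _ => rfl⟩
  -- coordinates of `g v`
  have hg : ∀ (v : EuclideanSpace ℝ (Fin 3)) (i : Fin 3), g v i = ∑ j, m i j * v j := by
    intro v i
    rw [show g v i = (g : EuclideanSpace ℝ (Fin 3) →L[ℝ] EuclideanSpace ℝ (Fin 3)) v i from rfl,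
      clm_apply_coord]
    refine Finset.sum_congr rfl fun j _ => ?_
    rw [show (g : EuclideanSpace ℝ (Fin 3) →L[ℝ] EuclideanSpace ℝ (Fin 3))
      (EuclideanSpace.single j (1 : ℝ)) i = g (EuclideanSpace.single j (1 : ℝ)) i from rfl, hm,
      mul_comm]
  -- the matrix of `g⁻¹` is the transpose
  have hsymm : ∀ j l : Fin 3, g.symm (EuclideanSpace.single j (1 : ℝ)) l = m j l := by
    intro j l
    have h1 : ⟪EuclideanSpace.single l (1 : ℝ), g.symm (EuclideanSpace.single j (1 : ℝ))⟫ =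
        g.symm (EuclideanSpace.single j (1 : ℝ)) l := by
      rw [EuclideanSpace.inner_single_left]; simp
    have h2 : ⟪g (EuclideanSpace.single l (1 : ℝ)), EuclideanSpace.single j (1 : ℝ)⟫ =
        g (EuclideanSpace.single l (1 : ℝ)) j := by
      rw [EuclideanSpace.inner_single_right]; simp
    rw [← h1, ← hm, ← h2, ← g.inner_map_map _ (g.symm _), g.apply_symm_apply]
  -- the rows of the matrix of `g` are orthonormal (`M Mᵀ = 1`)
  have hrow : ∀ i k : Fin 3, ∑ j, m i j * m k j = if i = k then 1 else 0 := by
    intro i k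
    have h : ⟪g.symm (EuclideanSpace.single i (1 : ℝ)), g.symm (EuclideanSpace.single k (1 : ℝ))⟫ =
        ⟪(EuclideanSpace.single i (1 : ℝ) : EuclideanSpace ℝ (Fin 3)),
          EuclideanSpace.single k (1 : ℝ)⟫ :=
      g.symm.inner_map_map _ _
    rw [PiLp.inner_apply, EuclideanSpace.inner_single_left] at h
    simp only [hsymm, map_one, one_mul, PiLp.single_apply, RCLike.inner_apply, conj_trivial] at h
    rw [← h]
    exact Finset.sum_congr rfl fun j _ => mul_comm _ _
  -- `det g = 1` in coordinates
  have hd : m 0 0 * m 1 1 * m 2 2 - m 0 0 * m 1 2 * m 2 1 - m 0 1 * m 1 0 * m 2 2 +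
      m 0 1 * m 1 2 * m 2 0 + m 0 2 * m 1 0 * m 2 1 - m 0 2 * m 1 1 * m 2 0 = 1 := by
    have h := LinearMap.det_toMatrix (EuclideanSpace.basisFun (Fin 3) ℝ).toBasis
      (g.toLinearEquiv : EuclideanSpace ℝ (Fin 3) →ₗ[ℝ] EuclideanSpace ℝ (Fin 3))
    rw [hdet, Matrix.det_fin_three] at h
    simpa [LinearMap.toMatrix_apply, hm] using h
  -- the entries of `g A g⁻¹`
  have hB : ∀ j i : Fin 3, g (A (g.symm (EuclideanSpace.single j (1 : ℝ)))) i =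
      ∑ k, ∑ l, m i k * (m j l * a l k) := by
    intro j i
    rw [hg]
    simp only [clm_apply_coord A (g.symm (EuclideanSpace.single j (1 : ℝ))), hsymm, ha,
      Finset.mul_sum]
  -- the two curl vectors in coordinates
  have hC : ∀ k : Fin 3,
      curlCLM ((g : EuclideanSpace ℝ (Fin 3) →L[ℝ] EuclideanSpace ℝ (Fin 3)).comp
        (A.comp (g.symm : EuclideanSpace ℝ (Fin 3) →L[ℝ] EuclideanSpace ℝ (Fin 3)))) k =
      ![g (A (g.symm (EuclideanSpace.single 1 (1 : ℝ)))) 2 -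
          g (A (g.symm (EuclideanSpace.single 2 (1 : ℝ)))) 1,
        g (A (g.symm (EuclideanSpace.single 2 (1 : ℝ)))) 0 -
          g (A (g.symm (EuclideanSpace.single 0 (1 : ℝ)))) 2,
        g (A (g.symm (EuclideanSpace.single 0 (1 : ℝ)))) 1 -
          g (A (g.symm (EuclideanSpace.single 1 (1 : ℝ)))) 0] k := by
    intro k
    rw [curlCLM_apply]
    fin_cases k <;> simp
  have hc : ∀ k : Fin 3, curlCLM A k = ![a 1 2 - a 2 1, a 2 0 - a 0 2, a 0 1 - a 1 0] k := by
    intro k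
    rw [curlCLM_apply]
    fin_cases k <;> simp [ha]
  ext i
  rw [hg (curlCLM A) i,
    curlEquivariant_conj_eq m a (fun j i => g (A (g.symm (EuclideanSpace.single j (1 : ℝ)))) i)
      _ _ hB hC hc hrow hd]

/-! ### The stub -/

/-- **Stub N26 (M/L): the vorticity of an equivariant field is equivariant under proper
rotations.** For a linear isometry `g` of `ℝ³` with `det g = 1` and a differentiable field `w`
with `w (g x) = g (w x)`, `curl w (g x) = g (curl w x)`: by the chain rule
`Dw(g x) = g ∘ Dw(x) ∘ g⁻¹` (`w = g ∘ w ∘ g⁻¹`), and the axial vector of a conjugated matrix is the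
rotated axial vector (`curlEquivariant_curlCLM_conj`; this is where `det g = 1` enters — for a
reflection the vorticity, a pseudovector, flips). (Majda–Bertozzi, §1.2, Prop. 1.1, rotation
symmetry of the Euler/Navier–Stokes equations.) The differentiability hypothesis is not needed
(both sides use the same junk Jacobian `0`), but is part of the registered signature. [folklore] -/
theorem stub_curlEquivariant :
    ∀ (g : EuclideanSpace ℝ (Fin 3) ≃ₗᵢ[ℝ] EuclideanSpace ℝ (Fin 3)),
      LinearMap.det (g.toLinearEquiv : EuclideanSpace ℝ (Fin 3) →ₗ[ℝ] EuclideanSpace ℝ (Fin 3)) = 1 →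
      ∀ w : EuclideanSpace ℝ (Fin 3) → EuclideanSpace ℝ (Fin 3), Differentiable ℝ w →
        (∀ x, w (g x) = g (w x)) → ∀ x, curl w (g x) = g (curl w x) := by
  intro g hdet w _ heq x
  have hfun : (fun y => g (w (g.symm y))) = w := funext fun y => by
    rw [← heq, LinearIsometryEquiv.apply_symm_apply]
  have hD : fderiv ℝ w (g x) =
      (g : EuclideanSpace ℝ (Fin 3) →L[ℝ] EuclideanSpace ℝ (Fin 3)).comp ((fderiv ℝ w x).comp
        (g.symm : EuclideanSpace ℝ (Fin 3) →L[ℝ] EuclideanSpace ℝ (Fin 3))) := by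
    have h := fderiv_conj_linearIsometryEquiv g w (g x)
    rwa [hfun, LinearIsometryEquiv.symm_apply_apply] at h
  rw [curl_eq_curlCLM, curl_eq_curlCLM, hD, curlEquivariant_curlCLM_conj g hdet]

end Summit.NavierStokesRegularity.NavierStokesRegularity.Theorems.PolyhedralDssProfileExists.PolyhedralCell
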